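import Mathlib.Analysis.Calculus.LineDeriv.IntegrationByParts
import Mathlib.MeasureTheory.Function.LocallyIntegrable
import Summits.AtomisticToContinuum.Crystallization.Theorems.FreeSplittingCertificatesStrictSplittingRuleFarPencilFlux

/-!
# `StrictSplittingRule` (stmt-AtomisticToContinuum-12560): the continuum far pencil, INTEGRATED — `∫ Num ≤ (17/200)·∫ Den`

Route `FreeSplittingCertificates`, crux r3 `StrictSplittingRule` (H12⋆ = `stub_coreJointCoercive`), unit b2b-freesplit-B gen 10.
VALUE = a tree THEOREM closing the analytic frame of the continuum far lemma (HOME CERT.md §16 (3), §17, §18) — NOT a proof of H12⋆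
(the lattice far ledger still needs the lattice→continuum transfer and the near certificate), NOT summit progress.

For every `C²` vector field `v : ℝ³ → ℝ³` (`(Fin 3 → ℝ) → (Fin 3 → ℝ)`) with compact support not containing the reference site `0`:
* `integral_fpFluxDeriv_eq_zero`: `∫ ∂ⱼΦⱼ = 0` for each `j` (Mathlib's integration by parts for line derivatives against the constant `1`);
* `integral_fpDivFlux_eq_zero`: **`∫ fpDivFlux x (v x) (∇v x) dx = 0`** (`div Φ = fpDivFlux` from `…FarPencilFlux`);
* `farPencil_integral_le`: **`∫ Num(x, v, ∇v) dx ≤ (17/200)·∫ Den(x, ∇v) dx`**, i.e. with `r = |x|`,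
  `∫ [(1/24)r⁻⁶|∇v|² + r⁻⁸(2⟪x̂,v⟫²·r²… ) ]` — precisely `∫ fpNum ≤ (17/200)∫ fpDen` for the densities of `…FarPencilPointwise`:
  readout `(1/24)r⁻⁶|∇v|²` plus bare `2r⁻¹⁰⟪x,v⟫² − ¼r⁻⁸|v|²` on the demand side, receipts `r⁻⁶·(4/5)((div v)² + 2|e(v)|²)` on the
  supply side — the far pencil inequality of CERT §16 (3) with the certified constant `17/200 = 0.085` (numerical supremum `0.08256`).
Ingredients: the pointwise certificate `farPencil_pointwise_le` (`Num + (1/18)div Φ ≤ (17/200)Den` at `x ≠ 0`; at `x = 0` every density is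
`0` by `0⁻¹ = 0`), continuity and compact support of all densities along a `C²` compactly supported field vanishing near `0`, and
`∫ div Φ = 0`.  HONEST FRAMING: a statement about TEST FIELDS in the continuum; NOT a proof of H12⋆, NOT summit progress.
-/

noncomputable section

open MeasureTheory Topology Filter

namespace Summit.AtomisticToContinuum.Crystallization.Theorems.StrictSplittingRuleBirth

variable {v : (Fin 3 → ℝ) → (Fin 3 → ℝ)}

/-! ## Vanishing off the support, continuity of the atoms -/

/-- Points of the support are nonzero when `0 ∉ tsupport v`. -/
theorem fp_zero_notMem_tsupport (h0 : (0 : Fin 3 → ℝ) ∉ tsupport v) {y : Fin 3 → ℝ} (hy : y ∈ tsupport v) : y ≠ 0 :=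
  fun h => h0 (h ▸ hy)

/-- `v = 0` off its topological support. -/
theorem fp_v_eq_zero {y : Fin 3 → ℝ} (hy : y ∉ tsupport v) : v y = 0 := image_eq_zero_of_notMem_tsupport hy

/-- `∇v = 0` off the topological support of `v`. -/
theorem fp_fderiv_eq_zero {y : Fin 3 → ℝ} (hy : y ∉ tsupport v) : fderiv ℝ v y = 0 :=
  image_eq_zero_of_notMem_tsupport fun h => hy (tsupport_fderiv_subset ℝ h)

/-- `∇²v = 0` off the topological support of `v`. -/
theorem fp_fderiv_fderiv_eq_zero {y : Fin 3 → ℝ} (hy : y ∉ tsupport v) : fderiv ℝ (fderiv ℝ v) y = 0 :=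
  image_eq_zero_of_notMem_tsupport fun h => hy (tsupport_fderiv_subset ℝ (tsupport_fderiv_subset ℝ h))

/-- `x ↦ |x|²` is continuous. -/
theorem continuous_fpSq : Continuous (fpSq : (Fin 3 → ℝ) → ℝ) := by
  unfold fpSq; fun_prop

/-- `x ↦ |x|⁻²` is continuous at every `x ≠ 0`. -/
theorem continuousAt_fpSq_inv {y : Fin 3 → ℝ} (hy : y ≠ 0) : ContinuousAt (fun z : Fin 3 → ℝ => (fpSq z)⁻¹) y :=
  continuous_fpSq.continuousAt.inv₀ (fpSq_ne_zero hy)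

/-- The gradient matrix of a `C²` field is continuous. -/
theorem continuous_fpGrad (hv : ContDiff ℝ 2 v) : Continuous (fpGrad v) := by
  have h := hv.continuous_fderiv (by simp)
  refine continuous_pi fun i => continuous_pi fun j => ?_
  exact (continuous_apply j).comp (h.clm_apply continuous_const)

/-- The second-derivative tensor of a `C²` field is continuous. -/
theorem continuous_fpHess (hv : ContDiff ℝ 2 v) : Continuous (fpHess v) := by
  have h1 : ContDiff ℝ 1 (fderiv ℝ v) := hv.fderiv_right (by norm_num)
  have h := h1.continuous_fderiv (by simp)
  refine continuous_pi fun k => continuous_pi fun i => continuous_pi fun j => ?_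
  exact (continuous_apply j).comp ((h.clm_apply continuous_const).clm_apply continuous_const)

/-- A real function that is continuous at every point of `tsupport v` and vanishes off it is continuous with compact support. -/
theorem fp_continuous_compact (hc : HasCompactSupport v) {g : (Fin 3 → ℝ) → ℝ}
    (hg : ∀ y ∈ tsupport v, ContinuousAt g y) (hz : ∀ y ∉ tsupport v, g y = 0) :
    Continuous g ∧ HasCompactSupport g := by
  refine ⟨continuous_iff_continuousAt.2 fun y => ?_, HasCompactSupport.intro hc hz⟩
  by_cases hy : y ∈ tsupport v
  · exact hg y hy
  · have hev : g =ᶠ[𝓝 y] fun _ => (0 : ℝ) :=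
      Filter.eventually_of_mem ((isClosed_tsupport v).isOpen_compl.mem_nhds hy) fun z hz' => hz z hz'
    exact hev.continuousAt

/-- …hence integrable. -/
theorem fp_integrable (hc : HasCompactSupport v) {g : (Fin 3 → ℝ) → ℝ}
    (hg : ∀ y ∈ tsupport v, ContinuousAt g y) (hz : ∀ y ∉ tsupport v, g y = 0) : Integrable g := by
  obtain ⟨h1, h2⟩ := fp_continuous_compact hc hg hz
  exact h1.integrable_of_hasCompactSupport h2

/-! ## Continuity of the densities on the support (`y ≠ 0`) -/

section cont
variable (hv : ContDiff ℝ 2 v) {y : Fin 3 → ℝ} (hy : y ≠ 0)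
include hv hy

/-- The flux `Φⱼ` is continuous at every `y ≠ 0` (for a `C²` field). -/
theorem continuousAt_fpFlux (j : Fin 3) : ContinuousAt (fun z => fpFlux v z j) y := by
  have hvc : Continuous v := hv.continuous
  have hGc : Continuous (fpGrad v) := continuous_fpGrad hv
  have hu := continuousAt_fpSq_inv hy
  have hA : Continuous fun z : Fin 3 → ℝ => fpSq (v z) * z j + 7 * fpDot z (v z) * v z j := by
    unfold fpSq fpDot; fun_prop
  have hB : Continuous fun z : Fin 3 → ℝ =>
      v z 0 * fpGrad v z 0 j + v z 1 * fpGrad v z 1 j + v z 2 * fpGrad v z 2 j - fpTr (fpGrad v z) * v z j := by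
    unfold fpTr; fun_prop
  exact ((hu.pow 4).mul hA.continuousAt).add ((hu.pow 3).mul hB.continuousAt)

/-- The flux derivative `∂ₖΦⱼ` is continuous at every `y ≠ 0` (for a `C²` field). -/
theorem continuousAt_fpFluxDeriv (j k : Fin 3) : ContinuousAt (fun z => fpFluxDeriv v z j k) y := by
  have hvc : Continuous v := hv.continuous
  have hGc : Continuous (fpGrad v) := continuous_fpGrad hv
  have hHc : Continuous (fpHess v) := continuous_fpHess hv
  have hu := continuousAt_fpSq_inv hy
  have hA : Continuous fun z : Fin 3 → ℝ => fpSq (v z) * z j + 7 * fpDot z (v z) * v z j := by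
    unfold fpSq fpDot; fun_prop
  have hA' : Continuous fun z : Fin 3 → ℝ =>
      2 * (v z 0 * fpGrad v z k 0 + v z 1 * fpGrad v z k 1 + v z 2 * fpGrad v z k 2) * z j +
        fpSq (v z) * fpE k j +
        7 * (fpDot (fpE k) (v z) + (z 0 * fpGrad v z k 0 + z 1 * fpGrad v z k 1 + z 2 * fpGrad v z k 2)) * v z j +
        7 * fpDot z (v z) * fpGrad v z k j := by
    unfold fpSq fpDot; fun_prop
  have hB : Continuous fun z : Fin 3 → ℝ =>
      v z 0 * fpGrad v z 0 j + v z 1 * fpGrad v z 1 j + v z 2 * fpGrad v z 2 j - fpTr (fpGrad v z) * v z j := by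
    unfold fpTr; fun_prop
  have hB' : Continuous fun z : Fin 3 → ℝ =>
      fpGrad v z k 0 * fpGrad v z 0 j + fpGrad v z k 1 * fpGrad v z 1 j + fpGrad v z k 2 * fpGrad v z 2 j +
        (v z 0 * fpHess v z k 0 j + v z 1 * fpHess v z k 1 j + v z 2 * fpHess v z k 2 j) -
        (fpHess v z k 0 0 + fpHess v z k 1 1 + fpHess v z k 2 2) * v z j -
        fpTr (fpGrad v z) * fpGrad v z k j := by
    unfold fpTr; fun_prop
  have hd : Continuous fun z : Fin 3 → ℝ => fpDot z (fpE k) := by unfold fpDot; fun_prop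
  unfold fpFluxDeriv
  exact (((((hd.continuousAt.const_mul (-8)).mul (hu.pow 5)).mul hA.continuousAt).add
    ((hu.pow 4).mul hA'.continuousAt)).sub (((hd.continuousAt.const_mul 6).mul (hu.pow 4)).mul hB.continuousAt)).add
    ((hu.pow 3).mul hB'.continuousAt)

/-- The demand density along the field is continuous at every `y ≠ 0`. -/
theorem continuousAt_fpNum : ContinuousAt (fun z => fpNum z (v z) (fpGrad v z)) y := by
  have hvc : Continuous v := hv.continuous
  have hGc : Continuous (fpGrad v) := continuous_fpGrad hv
  have hu := continuousAt_fpSq_inv hy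
  have hF : Continuous fun z : Fin 3 → ℝ => fpFrob (fpGrad v z) := by unfold fpFrob; fun_prop
  have hD : Continuous fun z : Fin 3 → ℝ => fpDot z (v z) ^ 2 := by unfold fpDot; fun_prop
  have hV : Continuous fun z : Fin 3 → ℝ => v z 0 ^ 2 + v z 1 ^ 2 + v z 2 ^ 2 := by fun_prop
  unfold fpNum
  exact ((((hu.pow 3).const_mul (1 / 24)).mul hF.continuousAt).add (((hu.pow 5).const_mul 2).mul hD.continuousAt)).sub
    (((hu.pow 4).const_mul (1 / 4)).mul hV.continuousAt)

/-- The receipts density along the field is continuous at every `y ≠ 0`. -/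
theorem continuousAt_fpDen : ContinuousAt (fun z => fpDen z (fpGrad v z)) y := by
  have hGc : Continuous (fpGrad v) := continuous_fpGrad hv
  have hu := continuousAt_fpSq_inv hy
  have hR : Continuous fun z : Fin 3 → ℝ => fpRec (fpGrad v z) := by unfold fpRec fpTr fpSymSq; fun_prop
  unfold fpDen
  exact (hu.pow 3).mul hR.continuousAt

end cont

/-! ## Vanishing of the densities off the support -/

/-- `Φⱼ = 0` off the support of `v`. -/
theorem fpFlux_eq_zero_of_notMem {y : Fin 3 → ℝ} (hy : y ∉ tsupport v) (j : Fin 3) : fpFlux v y j = 0 :=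
  fpFlux_eq_zero (fp_v_eq_zero hy) (fp_fderiv_eq_zero hy) j

/-- `∂ₖΦⱼ = 0` off the support of `v`. -/
theorem fpFluxDeriv_eq_zero_of_notMem {y : Fin 3 → ℝ} (hy : y ∉ tsupport v) (j k : Fin 3) :
    fpFluxDeriv v y j k = 0 :=
  fpFluxDeriv_eq_zero (fp_v_eq_zero hy) (fp_fderiv_eq_zero hy) (fp_fderiv_fderiv_eq_zero hy) j k

/-- The demand density vanishes off the support of `v`. -/
theorem fpNum_eq_zero_of_notMem {y : Fin 3 → ℝ} (hy : y ∉ tsupport v) : fpNum y (v y) (fpGrad v y) = 0 := by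
  simp [fpNum, fpGrad, fpFrob, fpDot, fp_v_eq_zero hy, fp_fderiv_eq_zero hy]

/-- The receipts density vanishes off the support of `v`. -/
theorem fpDen_eq_zero_of_notMem {y : Fin 3 → ℝ} (hy : y ∉ tsupport v) : fpDen y (fpGrad v y) = 0 := by
  simp [fpDen, fpRec, fpGrad, fpTr, fpSymSq, fp_fderiv_eq_zero hy]

/-- `fpDivFlux` vanishes off the support of `v`. -/
theorem fpDivFlux_eq_zero_of_notMem {y : Fin 3 → ℝ} (hy : y ∉ tsupport v) : fpDivFlux y (v y) (fpGrad v y) = 0 := by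
  simp [fpDivFlux, fpGrad, fpTr, fpTrSq, fpXGV, fpVGX, fpDot, fp_v_eq_zero hy, fp_fderiv_eq_zero hy]

/-! ## The flux is differentiable along every coordinate line, everywhere -/

/-- On the support (where `y ≠ 0` and `v` is `C²`): `∂ₖΦⱼ(y) = fpFluxDeriv v y j k`. -/
theorem hasLineDerivAt_fpFlux_of_mem (hv : ContDiff ℝ 2 v) (h0 : (0 : Fin 3 → ℝ) ∉ tsupport v)
    {y : Fin 3 → ℝ} (hy : y ∈ tsupport v) (j k : Fin 3) :
    HasLineDerivAt ℝ (fun z => fpFlux v z j) (fpFluxDeriv v y j k) y (fpE k) := by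
  have hy0 : y ≠ 0 := fp_zero_notMem_tsupport h0 hy
  have hd : DifferentiableAt ℝ v y := hv.differentiable (by simp) y
  have h1 : ContDiff ℝ 1 (fderiv ℝ v) := hv.fderiv_right (by norm_num)
  have hd2 : DifferentiableAt ℝ (fderiv ℝ v) y := h1.differentiable (by simp) y
  exact hasLineDerivAt_fpFlux hy0 hd hd2 j k

/-- Off the support: `Φⱼ` is locally zero, so `∂ₖΦⱼ(y) = 0 = fpFluxDeriv v y j k`. -/
theorem hasLineDerivAt_fpFlux_of_notMem {y : Fin 3 → ℝ} (hy : y ∉ tsupport v) (j k : Fin 3) :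
    HasLineDerivAt ℝ (fun z => fpFlux v z j) (fpFluxDeriv v y j k) y (fpE k) := by
  have hev : (fun z => fpFlux v z j) =ᶠ[𝓝 y] fun _ => (0 : ℝ) :=
    Filter.eventually_of_mem ((isClosed_tsupport v).isOpen_compl.mem_nhds hy)
      fun z hz => fpFlux_eq_zero_of_notMem hz j
  rw [fpFluxDeriv_eq_zero_of_notMem hy, hev.hasLineDerivAt_iff]
  show HasDerivAt (fun _ : ℝ => (0 : ℝ)) 0 0
  exact hasDerivAt_const _ _

/-- `∂ₖΦⱼ = fpFluxDeriv` at EVERY point, for a `C²` field whose support misses `0`. -/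
theorem hasLineDerivAt_fpFlux_all (hv : ContDiff ℝ 2 v) (h0 : (0 : Fin 3 → ℝ) ∉ tsupport v) (j k : Fin 3)
    (y : Fin 3 → ℝ) : HasLineDerivAt ℝ (fun z => fpFlux v z j) (fpFluxDeriv v y j k) y (fpE k) := by
  by_cases hy : y ∈ tsupport v
  · exact hasLineDerivAt_fpFlux_of_mem hv h0 hy j k
  · exact hasLineDerivAt_fpFlux_of_notMem hy j k

/-! ## Integration: `∫ ∂ⱼΦⱼ = 0`, `∫ div Φ = 0`, `∫ Num ≤ (17/200)∫ Den` -/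

/-- `Φⱼ` is integrable (continuous with compact support). -/
theorem integrable_fpFlux (hv : ContDiff ℝ 2 v) (hc : HasCompactSupport v) (h0 : (0 : Fin 3 → ℝ) ∉ tsupport v)
    (j : Fin 3) : Integrable fun y => fpFlux v y j :=
  fp_integrable hc (fun _ hy => continuousAt_fpFlux hv (fp_zero_notMem_tsupport h0 hy) j)
    (fun _ hy => fpFlux_eq_zero_of_notMem hy j)

/-- `∂ₖΦⱼ` is integrable (continuous with compact support). -/
theorem integrable_fpFluxDeriv (hv : ContDiff ℝ 2 v) (hc : HasCompactSupport v) (h0 : (0 : Fin 3 → ℝ) ∉ tsupport v)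
    (j k : Fin 3) : Integrable fun y => fpFluxDeriv v y j k :=
  fp_integrable hc (fun _ hy => continuousAt_fpFluxDeriv hv (fp_zero_notMem_tsupport h0 hy) j k)
    (fun _ hy => fpFluxDeriv_eq_zero_of_notMem hy j k)

/-- The demand density along the field is integrable. -/
theorem integrable_fpNum (hv : ContDiff ℝ 2 v) (hc : HasCompactSupport v) (h0 : (0 : Fin 3 → ℝ) ∉ tsupport v) :
    Integrable fun y => fpNum y (v y) (fpGrad v y) :=
  fp_integrable hc (fun _ hy => continuousAt_fpNum hv (fp_zero_notMem_tsupport h0 hy))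
    (fun _ hy => fpNum_eq_zero_of_notMem hy)

/-- The receipts density along the field is integrable. -/
theorem integrable_fpDen (hv : ContDiff ℝ 2 v) (hc : HasCompactSupport v) (h0 : (0 : Fin 3 → ℝ) ∉ tsupport v) :
    Integrable fun y => fpDen y (fpGrad v y) :=
  fp_integrable hc (fun _ hy => continuousAt_fpDen hv (fp_zero_notMem_tsupport h0 hy))
    (fun _ hy => fpDen_eq_zero_of_notMem hy)

/-- **`∫ ∂ⱼΦⱼ = 0`** — integration by parts for line derivatives (Mathlib) against the constant function `1`. -/
theorem integral_fpFluxDeriv_eq_zero (hv : ContDiff ℝ 2 v) (hc : HasCompactSupport v)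
    (h0 : (0 : Fin 3 → ℝ) ∉ tsupport v) (j : Fin 3) : ∫ y, fpFluxDeriv v y j j = 0 := by
  have hF := integrable_fpFlux hv hc h0 j
  have hF' := integrable_fpFluxDeriv hv hc h0 j j
  have h := integral_bilinear_hasLineDerivAt_right_eq_neg_left_of_integrable
    (μ := (volume : Measure (Fin 3 → ℝ))) (B := ContinuousLinearMap.mul ℝ ℝ) (v := fpE j)
    (f := fun z => fpFlux v z j) (f' := fun y => fpFluxDeriv v y j j)
    (g := fun _ => (1 : ℝ)) (g' := fun _ => (0 : ℝ))
    (by simpa using hF') (by simp) (by simpa using hF)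
    (fun y _ => hasLineDerivAt_fpFlux_all hv h0 j j y)
    (fun y _ => by
      show HasDerivAt (fun _ : ℝ => (1 : ℝ)) 0 0
      exact hasDerivAt_const _ _)
  simpa using h

/-- `div Φ = fpDivFlux` pointwise along the field (everywhere: on the support by the `C²` symmetry of second derivatives,
off the support both sides vanish). -/
theorem fpDivFlux_eq_sum_fpFluxDeriv (hv : ContDiff ℝ 2 v) (h0 : (0 : Fin 3 → ℝ) ∉ tsupport v) (y : Fin 3 → ℝ) :
    fpDivFlux y (v y) (fpGrad v y) = fpFluxDeriv v y 0 0 + fpFluxDeriv v y 1 1 + fpFluxDeriv v y 2 2 := by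
  by_cases hy : y ∈ tsupport v
  · exact (sum_fpFluxDeriv_eq_fpDivFlux_of_contDiffAt v (fp_zero_notMem_tsupport h0 hy) hv.contDiffAt).symm
  · rw [fpDivFlux_eq_zero_of_notMem hy, fpFluxDeriv_eq_zero_of_notMem hy, fpFluxDeriv_eq_zero_of_notMem hy,
      fpFluxDeriv_eq_zero_of_notMem hy]
    ring

/-- `fpDivFlux` along the field is integrable. -/
theorem integrable_fpDivFlux (hv : ContDiff ℝ 2 v) (hc : HasCompactSupport v) (h0 : (0 : Fin 3 → ℝ) ∉ tsupport v) :
    Integrable fun y => fpDivFlux y (v y) (fpGrad v y) := by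
  have h : (fun y => fpDivFlux y (v y) (fpGrad v y)) =
      fun y => fpFluxDeriv v y 0 0 + fpFluxDeriv v y 1 1 + fpFluxDeriv v y 2 2 :=
    funext (fpDivFlux_eq_sum_fpFluxDeriv hv h0)
  rw [h]
  exact ((integrable_fpFluxDeriv hv hc h0 0 0).add (integrable_fpFluxDeriv hv hc h0 1 1)).add
    (integrable_fpFluxDeriv hv hc h0 2 2)

/-- **`∫ div Φ = 0`**: the divergence density `fpDivFlux` of `…FarPencilPointwise` integrates to zero along every compactly supported
`C²` field vanishing near the reference site. -/
theorem integral_fpDivFlux_eq_zero (hv : ContDiff ℝ 2 v) (hc : HasCompactSupport v)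
    (h0 : (0 : Fin 3 → ℝ) ∉ tsupport v) : ∫ y, fpDivFlux y (v y) (fpGrad v y) = 0 := by
  have h : (fun y => fpDivFlux y (v y) (fpGrad v y)) =
      fun y => fpFluxDeriv v y 0 0 + fpFluxDeriv v y 1 1 + fpFluxDeriv v y 2 2 :=
    funext (fpDivFlux_eq_sum_fpFluxDeriv hv h0)
  have i0 := integrable_fpFluxDeriv hv hc h0 0 0
  have i1 := integrable_fpFluxDeriv hv hc h0 1 1
  have i2 := integrable_fpFluxDeriv hv hc h0 2 2
  have e1 : ∫ y, (fpFluxDeriv v y 0 0 + fpFluxDeriv v y 1 1 + fpFluxDeriv v y 2 2) =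
      (∫ y, (fpFluxDeriv v y 0 0 + fpFluxDeriv v y 1 1)) + ∫ y, fpFluxDeriv v y 2 2 :=
    integral_add (i0.add i1) i2
  have e2 : ∫ y, (fpFluxDeriv v y 0 0 + fpFluxDeriv v y 1 1) =
      (∫ y, fpFluxDeriv v y 0 0) + ∫ y, fpFluxDeriv v y 1 1 :=
    integral_add i0 i1
  rw [h, e1, e2, integral_fpFluxDeriv_eq_zero hv hc h0 0, integral_fpFluxDeriv_eq_zero hv hc h0 1,
    integral_fpFluxDeriv_eq_zero hv hc h0 2]
  ring

/-- The pointwise certificate everywhere (at `x = 0` every density vanishes since `0⁻¹ = 0`). -/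
theorem farPencil_pointwise_le' (x w : Fin 3 → ℝ) (G : Fin 3 → Fin 3 → ℝ) :
    fpNum x w G + 1 / 18 * fpDivFlux x w G ≤ 17 / 200 * fpDen x G := by
  by_cases hx : x = 0
  · subst hx
    simp [fpNum, fpDivFlux, fpDen, fpSq]
  · exact farPencil_pointwise_le x w G hx

/-- **THE CONTINUUM FAR PENCIL, INTEGRATED.**  For every `C²` vector field `v : ℝ³ → ℝ³` with compact support not containing `0`:
`∫ fpNum x (v x) (∇v x) dx ≤ (17/200)·∫ fpDen x (∇v x) dx`, i.e.
`∫ [(1/24)|x|⁻⁶|∇v|² + 2|x|⁻¹⁰⟪x,v⟫² − ¼|x|⁻⁸|v|²] dx ≤ (17/200)·∫ |x|⁻⁶·(4/5)((div v)² + 2|e(v)|²) dx`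
(readout + bare demand ≤ `0.085 ×` twelve-design receipts).  VALUE = the analytic frame of CERT §16 (3) as a theorem about test
fields; NOT a proof of H12⋆, NOT summit progress. -/
theorem farPencil_integral_le (hv : ContDiff ℝ 2 v) (hc : HasCompactSupport v) (h0 : (0 : Fin 3 → ℝ) ∉ tsupport v) :
    ∫ x, fpNum x (v x) (fpGrad v x) ≤ 17 / 200 * ∫ x, fpDen x (fpGrad v x) := by
  have hN := integrable_fpNum hv hc h0
  have hD := integrable_fpDen hv hc h0
  have hΦ := integrable_fpDivFlux hv hc h0
  have h1 : ∫ x, fpNum x (v x) (fpGrad v x) =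
      ∫ x, (fpNum x (v x) (fpGrad v x) + 1 / 18 * fpDivFlux x (v x) (fpGrad v x)) := by
    rw [integral_add hN (hΦ.const_mul _), integral_const_mul, integral_fpDivFlux_eq_zero hv hc h0]
    ring
  have h2 : ∫ x, (fpNum x (v x) (fpGrad v x) + 1 / 18 * fpDivFlux x (v x) (fpGrad v x)) ≤
      ∫ x, 17 / 200 * fpDen x (fpGrad v x) :=
    integral_mono (hN.add (hΦ.const_mul _)) (hD.const_mul _) fun x => farPencil_pointwise_le' x (v x) (fpGrad v x)
  rw [h1]
  refine h2.trans_eq ?_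
  exact integral_const_mul _ _

/-- The same with the hypothesis `v = 0` near `0` phrased as an eventual equality. -/
theorem farPencil_integral_le_of_eventuallyEq (hv : ContDiff ℝ 2 v) (hc : HasCompactSupport v)
    (h0 : v =ᶠ[𝓝 0] 0) :
    ∫ x, fpNum x (v x) (fpGrad v x) ≤ 17 / 200 * ∫ x, fpDen x (fpGrad v x) :=
  farPencil_integral_le hv hc (notMem_tsupport_iff_eventuallyEq.2 h0)

end Summit.AtomisticToContinuum.Crystallization.Theorems.StrictSplittingRuleBirth
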